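import Mathlib
import Literature.Analysis.SpecialFunctions.ThetaRiemannSum
import HarnessLib

/-!
# Barrier: chirped theta bows are `B^{-C}`-invisible to two-sided power-sum tests on `[A, 2A]` (Maynard–Pratt 2024, Remark 13(3) and §8; Jacobi's imaginary transformation)

Barrier catalogue `Literature/Barriers/RiemannHypothesis/` (D-0021), entry `ThetaBowInvisibility`
(namespace `Literature.Barriers.RiemannHypothesis`; the catalogued declaration is
`ThetaBowInvisibility`, PROVED outright in `thetaBowInvisibility_holds` — no vendored facts; the
helpers live in the sub-namespace `ThetaBow`).

## The technique (inverse theorems for two-sided positive power sums; "fences")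

Maynard–Pratt detect a zero `ρ₀` of `ζ` through the local power sum
`F(t) = Σ_r c_r e^{t z_r}`, `z_r = ρ_r − ρ₀`, `c_r = W(z_r)·m_r` (`W` the Mellin transform of a
smooth bump `w` on `[1/2, 2]`, `m_r` multiplicities), `t = log U ∈ [A, 2A]`, `B = Σ|c_r|`
(explicit formula, Prop. 16): `ρ₀` is detected unless `sup_{t∈[A,2A]} |F(t)| ≤ B^{-C}`. Their
Lemma 11 forces detection when the configuration is ONE-sided (`Im z_r ≥ 0`), and they ask for the
inverse theorem in the two-sided case: "One might speculate that the only obstruction to `S_Y(ρ₀)`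
being uniformly small in this way is caused by the local distribution of zeros being a pertubation
of a small number of vertical arithmetic progressions" (§2.2), and "If one could show that the only
configurations of points where the corresponding sums are uniformly small come from a small number
of vertical arithmetic progressions, then detecting bows of zeros would be essentially the only
obstacle to an unconditional result" (§8). The known mechanism for super-polynomial smallness is
Poisson summation over a LATTICE with a smooth envelope: "If we choose a smooth non-negative
function `f` supported on `[0,1]`, `c_r = f(r/R)` and `z_r = πir/(2A)`, then we see that by Poisson
summation ... the sum is `O_j(R^{-j})`" (Remark 13, third bullet). A route on this hub
(`RiemannHypothesis/Fences`, rev ≤ 2) typed the hoped-for inverse theorem as the crux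
`InverseTuranLattice` (stmt-RiemannHypothesis-2994): `sup ≤ B^{-C}` ⇒ `0` lies on a fully
occupied near-lattice `{ijs}` (step `s(2A+1) < 2π`, tolerance `B^{-2}`, window `|j|s ≤ (log B)³`).

## The obstruction (proved here): Gaussian-damped chirps ("theta bows") are equally invisible

For `X ∈ ℕ`, `A > 0` put `z_x = (−x²/X + iπx/2)/A`, `|x| ≤ X` (`ThetaBow.node`,
`ThetaBow.nodes`; `z_0 = 0`, `Re z_x ≤ 0`, multiplicities `1`). For EVERY continuous `w ≥ 0`
with `supp w ⊆ [1/2, 2]` and `W(0) = ∫ w(u) du/u = 1` (no decay of `W` is used — the bound is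
uniform in `w`):

* `ThetaBow.norm_powerSum_le`: for `X ≥ 6`, `A ≥ 30X`, `t ∈ [A, 2A]`,
  `‖Σ_x W(z_x) e^{t z_x}‖ ≤ 19 X e^{−X/6}`. Proof: `W(z) e^{tz} = ∫ (w(u)/u) e^{(t + log u) z} du`,
  so `F(t) = ∫ (w(u)/u) G_X((t + log u)/A) du` with the truncated chirped theta sum
  `G_X(τ) = Σ_{|x|≤X} exp(−(τ/X)x² + i(πτ/2)x)`, `τ ∈ [9/10, 21/10]`; the full sum over `x ∈ ℤ` is,
  by Jacobi's imaginary transformation (Mathlib `Complex.tsum_exp_neg_quadratic`, `a = τ/(πX)`,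
  `b = iτ/4`), `√(πX/τ) Σ_n exp(−(π²X/τ)(n − τ/4)²)`, and `τ/4 ∈ [1/5, 11/20]` stays away from
  `ℤ` — exactly Maynard–Pratt's "`−t/(4A)` is always at least `1/4` away from any integer" — so it
  is `≤ (40X/9)·3e^{−X/6}` (`ThetaBow.norm_tsum_exp_base_le`, via `(n − c)² ≥ (1 + n²)/25` and
  `Literature.Analysis.SpecialFunctions.gaussLatticeSum_le_three`); the Gaussian damping makes the
  truncation tail `≤ 5X e^{−X/6}` (`ThetaBow.norm_tsum_sub_thetaTrunc_le`).
* `ThetaBow.weight_bounds`: `(6/7)(2X+1) ≤ B = Σ_x ‖W(z_x)‖ ≤ (8/7)(2X+1)` (`‖W(z) − 1‖ ≤ 7/50`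
  for `‖z‖ ≤ 1/10`), so `19Xe^{−X/6} ≤ B^{−C}` for `X ≥ X₀(C)` (`ThetaBow.eventually_X`).
* `ThetaBow.node_small`: every node has `|Im z_x| ≤ 1/15`, `‖z_x‖ ≤ 1/10`, while
  `(log B)³ ≥ 27`: no node is anywhere near the sites `ijs`, `1 ≤ js ≤ (log B)³`, of ANY lattice
  through `0` — the ordinates do form the progression `πx/(2A)` (Maynard–Pratt's own step), but the
  abscissae dive to depth `x²/(XA) ≫ B^{−2}` (a bow) and the whole configuration has height
  `≤ 1/15`.

Hence `ThetaBowInvisibility` (for every admissible `w` and every `C`: eventually in `X`, for all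
`A ≥ 30X`, the theta bow satisfies the `B^{−C}` hypothesis with `27 ≤ B ≤ 5X/2` and the geometry
above), and the corollary `not_inverseTuranLattice` — the typed crux stmt-RiemannHypothesis-2994 is
FALSE (its statement is reproduced verbatim in the theorem; witness `w = ThetaBow.wit`, a
normalised `ContDiffBump`; the refutation `ThetaBow.not_inverseTuranLattice_of_admissible` holds for
every admissible `w`, so adding decay hypotheses on `W` — e.g. Maynard–Pratt's
`|W(x+iy)| ≪ e^{−√(|y|/2)}`, Lemma 43 — changes nothing). On paper the same family with a complex
chirp `z_x = (−(0.8−0.4i)x²/X + iπx/2)/A` (ordinate gaps varying by a factor `3`, no progression at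
all) is equally invisible (refuter evidence on stmt-2994, 2026-08-16: `sup = 1.53·10⁻²³` at
`X = 100`, `1.65·10⁻⁵⁹` at `X = 250`, matching the Jacobi prediction to all digits), which is why
the route's planner dropped the lattice conclusion (route rev 3–4) rather than shrinking the window.

What is NOT claimed: nothing here says two-sided configurations are undetectable by other tests,
nor that `ζ` has bows; Maynard–Pratt's one-sided Lemma 11 and Prop. 16 are untouched. The barrier
only kills inverse statements of the shape "uniformly `B^{−C}`-small on `[A,2A]` ⇒ the nodes near
`0` contain / lie on a (near-)arithmetic progression of prescribed extent or at a common abscissa".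

## References

* [MaynardPratt2024] J. Maynard, K. Pratt, *Half-isolated zeros and zero-density estimates*,
  IMRN 2024:19, 12978–13014 (arXiv:2206.11729): §2.2 (the speculation), Lemma 11, Remarks 12–13
  (Remark 13, third bullet: the Poisson/lattice mechanism with `z_r = πir/(2A)`), Prop. 16, §8
  ("bows"; the inverse question) — read from the held text, pages 5, 8, 20.
* [Montgomery1994] H. L. Montgomery, *Ten Lectures on the Interface between Analytic Number Theory
  and Harmonic Analysis*, ch. 5 (Turán's power-sum method), cited by Maynard–Pratt, Remark 12.
-/

noncomputable section

open scoped Real Topology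
open Complex (I)
open _root_.MeasureTheory _root_.Set _root_.Filter

namespace Literature.Barriers.RiemannHypothesis

namespace ThetaBow

open Literature.Analysis.SpecialFunctions

/-! ## A. Gaussian sums over `ℤ` -/

/-- `n ↦ e^{-c n²}` is summable over `ℤ` (`c > 0`). [folklore] -/
theorem summable_int_gauss {c : ℝ} (hc : 0 < c) :
    Summable fun n : ℤ => Real.exp (-(c * (n : ℝ) ^ 2)) := by
  have h : ∀ g : ℕ → ℤ, (∀ i : ℕ, ((g i : ℤ) : ℝ) ^ 2 = (i : ℝ) ^ 2) →
      Summable fun i : ℕ => Real.exp (-(c * ((g i : ℤ) : ℝ) ^ 2)) := by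
    intro g hg
    have := Real.summable_exp_nat_mul_of_ge (neg_lt_zero.2 hc) (f := fun i : ℕ => (i : ℝ) ^ 2)
      (fun i => by
        rcases Nat.eq_zero_or_pos i with h0 | h0
        · simp [h0]
        · have h1 : (1 : ℝ) ≤ i := by exact_mod_cast h0
          nlinarith)
    refine this.congr fun i => ?_
    rw [hg]
    ring_nf
  rw [summable_int_iff_summable_nat_and_neg]
  exact ⟨h (fun i => (i : ℤ)) (fun i => by push_cast; ring),
    h (fun i => -(i : ℤ)) (fun i => by push_cast; ring)⟩

/-- Key inequality: for `c ∈ [1/5, 11/20]` and every integer `n`, `(n - c)² ≥ (1 + n²)/25`. [folklore] -/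
theorem key_ineq (n : ℤ) {c : ℝ} (hc1 : 1 / 5 ≤ c) (hc2 : c ≤ 11 / 20) :
    (1 + (n : ℝ) ^ 2) / 25 ≤ ((n : ℝ) - c) ^ 2 := by
  rcases lt_trichotomy n 0 with hn | rfl | hn
  · have hn' : (n : ℝ) ≤ -1 := by exact_mod_cast (Int.le_sub_one_iff.2 hn)
    nlinarith [mul_nonneg (by linarith : (0 : ℝ) ≤ c) (by linarith : (0 : ℝ) ≤ -(n : ℝ))]
  · push_cast
    nlinarith
  · by_cases h1 : n = 1
    · subst h1
      push_cast
      nlinarith [mul_nonneg (sub_nonneg.2 hc2) (sub_nonneg.2 hc2)]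
    · have h2 : (2 : ℝ) ≤ n := by exact_mod_cast (show (2 : ℤ) ≤ n by omega)
      nlinarith [mul_nonneg (sub_nonneg.2 h2) (by linarith : (0 : ℝ) ≤ (n : ℝ))]

/-- Shifted Gaussian sum: `Σ_{n ∈ ℤ} e^{-K (n - c)²} ≤ 3 e^{-K/25}` for `K ≥ 25`, `c ∈ [1/5, 11/20]`. [folklore] -/
theorem tsum_shifted_gauss_le {K c : ℝ} (hK : 25 ≤ K) (hc1 : 1 / 5 ≤ c) (hc2 : c ≤ 11 / 20) :
    Summable (fun n : ℤ => Real.exp (-(K * ((n : ℝ) - c) ^ 2))) ∧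
      ∑' n : ℤ, Real.exp (-(K * ((n : ℝ) - c) ^ 2)) ≤ 3 * Real.exp (-(K / 25)) := by
  have hK0 : 0 < K := by linarith
  set g : ℤ → ℝ := fun n => Real.exp (-(K / 25)) * Real.exp (-(K / 25 * (n : ℝ) ^ 2)) with hg
  have hgs : Summable g := (summable_int_gauss (by positivity : 0 < K / 25)).mul_left _
  have hle : ∀ n : ℤ, Real.exp (-(K * ((n : ℝ) - c) ^ 2)) ≤ g n := by
    intro n
    simp only [hg, ← Real.exp_add]
    apply Real.exp_le_exp.2
    have := key_ineq n hc1 hc2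
    nlinarith [mul_le_mul_of_nonneg_left this hK0.le]
  have hfs : Summable (fun n : ℤ => Real.exp (-(K * ((n : ℝ) - c) ^ 2))) :=
    Summable.of_nonneg_of_le (fun n => (Real.exp_pos _).le) hle hgs
  refine ⟨hfs, ?_⟩
  calc ∑' n : ℤ, Real.exp (-(K * ((n : ℝ) - c) ^ 2)) ≤ ∑' n, g n := hfs.tsum_le_tsum hle hgs
    _ = Real.exp (-(K / 25)) * gaussLatticeSum (K / 25) := by
        simp only [hg, tsum_mul_left, gaussLatticeSum]
    _ ≤ Real.exp (-(K / 25)) * 3 := by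
        gcongr
        exact gaussLatticeSum_le_three (by linarith)
    _ = 3 * Real.exp (-(K / 25)) := by ring

/-! ## B. The theta bow: exponents, full sum (Jacobi) and truncation -/

/-- `A·z_x`: the un-normalised theta-bow exponent `-x²/X + iπx/2`. [folklore] -/
def base (X : ℕ) (x : ℤ) : ℂ := ⟨-((x : ℝ) ^ 2 / X), π * x / 2⟩

/-- Real part of `base`. [folklore] -/
@[simp] theorem base_re (X : ℕ) (x : ℤ) : (base X x).re = -((x : ℝ) ^ 2 / X) := rfl

/-- Imaginary part of `base`. [folklore] -/
@[simp] theorem base_im (X : ℕ) (x : ℤ) : (base X x).im = π * x / 2 := rfl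

/-- `Re(τ · base x) = −(τ/X) x²`. [folklore] -/
theorem ofReal_mul_base_re (X : ℕ) (τ : ℝ) (x : ℤ) :
    ((τ : ℂ) * base X x).re = -(τ / X * (x : ℝ) ^ 2) := by
  simp [Complex.mul_re]
  ring

/-- `‖e^{τ·base x}‖ = e^{−(τ/X)x²}` (the Gaussian damping). [folklore] -/
theorem norm_exp_base (X : ℕ) (τ : ℝ) (x : ℤ) :
    ‖Complex.exp (τ * base X x)‖ = Real.exp (-(τ / X * (x : ℝ) ^ 2)) := by
  rw [Complex.norm_exp, ofReal_mul_base_re]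

/-- The truncated theta sum `G_X(τ) = Σ_{|x| ≤ X} exp(τ·(-x²/X + iπx/2))`. [folklore] -/
def thetaTrunc (X : ℕ) (τ : ℝ) : ℂ :=
  ∑ n ∈ Finset.Icc (-(X : ℤ)) X, Complex.exp (τ * base X n)

/-- Full theta sum: summable, and `‖Σ_{n ∈ ℤ} e^{τ·base n}‖ ≤ 14 X e^{-X/6}` for `τ ∈ [9/10, 21/10]`,
`X ≥ 6` (Jacobi imaginary transformation `Complex.tsum_exp_neg_quadratic` + `tsum_shifted_gauss_le`). [folklore] -/
theorem norm_tsum_exp_base_le {X : ℕ} {τ : ℝ} (hX : 6 ≤ X) (hτ1 : 9 / 10 ≤ τ) (hτ2 : τ ≤ 21 / 10) :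
    Summable (fun n : ℤ => Complex.exp (τ * base X n)) ∧
      ‖∑' n : ℤ, Complex.exp (τ * base X n)‖ ≤ 14 * X * Real.exp (-(X / 6)) := by
  have hX' : (6 : ℝ) ≤ X := by exact_mod_cast hX
  have hXpos : (0 : ℝ) < X := by linarith
  have hτ0 : 0 < τ := by linarith
  have hπ3 := Real.pi_gt_three
  have hπ4 := Real.pi_lt_four
  -- summability from the norm
  have hsum : Summable (fun n : ℤ => Complex.exp (τ * base X n)) := by
    refine Summable.of_norm ?_
    simp only [norm_exp_base]
    exact summable_int_gauss (by positivity)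
  refine ⟨hsum, ?_⟩
  -- Jacobi
  set a : ℝ := τ / (π * X) with ha_def
  have ha : 0 < a := by positivity
  set b : ℂ := I * ((τ / 4 : ℝ) : ℂ) with hb_def
  have hsummand : ∀ n : ℤ, (τ : ℂ) * base X n = -π * (a : ℂ) * (n : ℂ) ^ 2 + 2 * π * b * n := by
    intro n
    have hπ0 : (π : ℝ) ≠ 0 := Real.pi_ne_zero
    apply Complex.ext
    · simp [Complex.mul_re, Complex.mul_im, hb_def, sq]
      rw [ha_def]
      field_simp
    · simp [Complex.mul_re, Complex.mul_im, hb_def, sq]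
      ring
  have ha' : 0 < ((a : ℝ) : ℂ).re := by simpa using ha
  have hJ := Complex.tsum_exp_neg_quadratic ha' b
  set K : ℝ := π / a with hK_def
  have hKeq : K = π ^ 2 * X / τ := by
    rw [hK_def, ha_def]
    field_simp
  have hK25 : 25 ≤ K := by
    rw [hKeq, le_div_iff₀ hτ0]
    nlinarith
  have hdual : ∀ n : ℤ, Complex.exp (-π / (a : ℂ) * ((n : ℂ) + I * b) ^ 2) =
      ((Real.exp (-(K * ((n : ℝ) - τ / 4) ^ 2)) : ℝ) : ℂ) := by
    intro n
    rw [Complex.ofReal_exp]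
    congr 1
    have hI : (n : ℂ) + I * b = ((n - τ / 4 : ℝ) : ℂ) := by
      rw [hb_def, ← mul_assoc, Complex.I_mul_I]
      push_cast
      ring
    rw [hI, hK_def]
    push_cast
    ring
  have hS := tsum_shifted_gauss_le hK25 (c := τ / 4) (by linarith) (by linarith)
  obtain ⟨hSs, hSle⟩ := hS
  have hS0 : 0 ≤ ∑' n : ℤ, Real.exp (-(K * ((n : ℝ) - τ / 4) ^ 2)) :=
    tsum_nonneg fun n => (Real.exp_pos _).le
  -- rewrite our sum through Jacobi
  have hours : ∑' n : ℤ, Complex.exp (τ * base X n) =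
      1 / (a : ℂ) ^ (1 / 2 : ℂ) * ((∑' n : ℤ, Real.exp (-(K * ((n : ℝ) - τ / 4) ^ 2)) : ℝ) : ℂ) := by
    rw [Complex.ofReal_tsum]
    simp_rw [← hdual, hsummand]
    exact hJ
  rw [hours, norm_mul, Complex.norm_real, Real.norm_eq_abs, abs_of_nonneg hS0]
  -- the prefactor
  have hpre : ‖1 / (a : ℂ) ^ (1 / 2 : ℂ)‖ ≤ 40 / 9 * X := by
    rw [norm_div, norm_one, show (1 / 2 : ℂ) = ((1 / 2 : ℝ) : ℂ) by push_cast; ring,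
      Complex.norm_cpow_eq_rpow_re_of_pos ha, Complex.ofReal_re]
    have hainv : 1 ≤ a⁻¹ := by
      rw [ha_def, inv_div, le_div_iff₀ hτ0]
      nlinarith
    calc 1 / a ^ (1 / 2 : ℝ) = a⁻¹ ^ (1 / 2 : ℝ) := by
          rw [Real.inv_rpow ha.le, one_div]
      _ ≤ a⁻¹ ^ (1 : ℝ) := Real.rpow_le_rpow_of_exponent_le hainv (by norm_num)
      _ = a⁻¹ := Real.rpow_one _
      _ ≤ 40 / 9 * X := by
          rw [ha_def, inv_div, div_le_iff₀ hτ0]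
          nlinarith
  have hexp : Real.exp (-(K / 25)) ≤ Real.exp (-(X / 6)) := by
    apply Real.exp_le_exp.2
    rw [hKeq]
    rw [neg_le_neg_iff, div_le_div_iff₀ (by norm_num) (by norm_num), div_mul_eq_mul_div,
      le_div_iff₀ hτ0]
    have hπ2 : 9 < π ^ 2 := by nlinarith
    nlinarith [mul_le_mul_of_nonneg_left hτ2 hXpos.le, mul_lt_mul_of_pos_right hπ2 hXpos]
  calc ‖1 / (a : ℂ) ^ (1 / 2 : ℂ)‖ * ∑' n : ℤ, Real.exp (-(K * ((n : ℝ) - τ / 4) ^ 2))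
      ≤ (40 / 9 * X) * (3 * Real.exp (-(K / 25))) := by gcongr
    _ ≤ (40 / 9 * X) * (3 * Real.exp (-(X / 6))) := by gcongr
    _ ≤ 14 * X * Real.exp (-(X / 6)) := by nlinarith [Real.exp_pos (-(X / 6 : ℝ))]


/-- Truncation: `‖Σ_{n ∈ ℤ} f n - Σ_{|n| ≤ X} f n‖ ≤ 5 X e^{-X/6}` for the theta-bow terms. [folklore] -/
theorem norm_tsum_sub_thetaTrunc_le {X : ℕ} {τ : ℝ} (hX : 6 ≤ X) (hτ1 : 9 / 10 ≤ τ)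
    (hs : Summable (fun n : ℤ => Complex.exp (τ * base X n))) :
    ‖∑' n : ℤ, Complex.exp (τ * base X n) - thetaTrunc X τ‖ ≤ 5 * X * Real.exp (-(X / 6)) := by
  have hX' : (6 : ℝ) ≤ X := by exact_mod_cast hX
  have hXpos : (0 : ℝ) < X := by linarith
  have hτ0 : 0 < τ := by linarith
  set f : ℤ → ℂ := fun n => Complex.exp (τ * base X n) with hf
  set s : Finset ℤ := Finset.Icc (-(X : ℤ)) X with hs_def
  have htail : ∑' n, f n - thetaTrunc X τ = ∑' x : ↑((s : Set ℤ)ᶜ), f x := by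
    rw [← hs.sum_add_tsum_compl (s := s), thetaTrunc]
    ring
  rw [htail]
  set g : ℤ → ℝ := fun n => Real.exp (-(τ * X / 2)) * Real.exp (-(τ / (2 * X) * (n : ℝ) ^ 2))
    with hg
  have hg0 : ∀ n, 0 ≤ g n := fun n => by positivity
  have hgs : Summable g := (summable_int_gauss (by positivity : 0 < τ / (2 * X))).mul_left _
  have hnorm_s : Summable fun x : ↑((s : Set ℤ)ᶜ) => ‖f x‖ := hs.norm.subtype _
  have hdom : ∀ x : ↑((s : Set ℤ)ᶜ), ‖f x‖ ≤ g x := by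
    rintro ⟨n, hn⟩
    have hn' : (X : ℤ) + 1 ≤ |n| := by
      simp only [hs_def, Set.mem_compl_iff, Finset.mem_coe, Finset.mem_Icc, not_and_or, not_le] at hn
      rcases abs_cases n with ⟨h, _⟩ | ⟨h, _⟩ <;> omega
    have hn2 : (X : ℝ) ^ 2 ≤ (n : ℝ) ^ 2 := by
      have h1 : ((X : ℤ) : ℝ) + 1 ≤ ((|n| : ℤ) : ℝ) := by exact_mod_cast hn'
      rw [Int.cast_abs] at h1
      push_cast at h1
      nlinarith [abs_nonneg (n : ℝ), sq_abs (n : ℝ)]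
    simp only [hf, hg, norm_exp_base, ← Real.exp_add]
    apply Real.exp_le_exp.2
    have key : 0 ≤ τ / (2 * X) * ((n : ℝ) ^ 2 - X ^ 2) :=
      mul_nonneg (by positivity) (sub_nonneg.2 hn2)
    have hid : -(τ * X / 2) + -(τ / (2 * X) * (n : ℝ) ^ 2) - (-(τ / X * (n : ℝ) ^ 2)) =
        τ / (2 * X) * ((n : ℝ) ^ 2 - X ^ 2) := by
      field_simp
      ring
    linarith
  have hq : 0 < τ / (2 * X) := by positivity
  calc ‖∑' x : ↑((s : Set ℤ)ᶜ), f x‖ ≤ ∑' x : ↑((s : Set ℤ)ᶜ), ‖f x‖ := norm_tsum_le_tsum_norm hnorm_s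
    _ ≤ ∑' x : ↑((s : Set ℤ)ᶜ), g x := hnorm_s.tsum_le_tsum hdom (hgs.subtype _)
    _ ≤ ∑' n : ℤ, g n := hgs.tsum_subtype_le g _ hg0
    _ = Real.exp (-(τ * X / 2)) * gaussLatticeSum (τ / (2 * X)) := by
        simp only [hg, tsum_mul_left, gaussLatticeSum]
    _ ≤ Real.exp (-(τ * X / 2)) * (1 + 2 / (Real.exp (τ / (2 * X)) - 1)) := by
        gcongr
        exact gaussLatticeSum_le hq
    _ ≤ Real.exp (-(X / 6)) * (1 + 40 / 9 * X) := by
        have h1 : Real.exp (-(τ * X / 2)) ≤ Real.exp (-(X / 6)) :=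
          Real.exp_le_exp.2 (by nlinarith)
        have h2 : τ / (2 * X) ≤ Real.exp (τ / (2 * X)) - 1 := by
          linarith [Real.add_one_le_exp (τ / (2 * X))]
        have h3 : 2 / (Real.exp (τ / (2 * X)) - 1) ≤ 2 / (τ / (2 * X)) :=
          div_le_div_of_nonneg_left (by norm_num) hq h2
        have h4 : 2 / (τ / (2 * X)) ≤ 40 / 9 * X := by
          rw [div_div_eq_mul_div, div_le_iff₀ hτ0]
          nlinarith
        have h5 : 0 ≤ 2 / (Real.exp (τ / (2 * X)) - 1) := div_nonneg (by norm_num) (by linarith)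
        gcongr
        linarith
    _ ≤ 5 * X * Real.exp (-(X / 6)) := by nlinarith [Real.exp_pos (-(X / 6 : ℝ))]

/-- The truncated theta sum is uniformly tiny: `‖G_X(τ)‖ ≤ 19 X e^{-X/6}` for `τ ∈ [9/10, 21/10]`,
`X ≥ 6`. [folklore] -/
theorem norm_thetaTrunc_le {X : ℕ} {τ : ℝ} (hX : 6 ≤ X) (hτ1 : 9 / 10 ≤ τ) (hτ2 : τ ≤ 21 / 10) :
    ‖thetaTrunc X τ‖ ≤ 19 * X * Real.exp (-(X / 6)) := by
  obtain ⟨hs, hfull⟩ := norm_tsum_exp_base_le hX hτ1 hτ2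
  have htail := norm_tsum_sub_thetaTrunc_le hX hτ1 hs
  have : thetaTrunc X τ = ∑' n : ℤ, Complex.exp (τ * base X n) -
      (∑' n : ℤ, Complex.exp (τ * base X n) - thetaTrunc X τ) := by ring
  rw [this]
  refine (norm_sub_le _ _).trans ?_
  linarith

/-- `G_X` is continuous in `τ`. [folklore] -/
theorem continuous_thetaTrunc (X : ℕ) : Continuous fun τ : ℝ => thetaTrunc X τ := by
  unfold thetaTrunc
  fun_prop

/-! ## C. Mellin transforms of bumps supported in `[1/2, 2]` -/

section Mellin

variable {w : ℝ → ℝ}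

/-- Points of `[1/2, 2]` are positive. [folklore] -/
theorem Icc_pos {u : ℝ} (hu : u ∈ Icc (1 / 2 : ℝ) 2) : 0 < u := lt_of_lt_of_le (by norm_num) hu.1

/-- `W(z) = ∫_{1/2}^{2} (w(u)/u) u^z du` when `supp w ⊆ [1/2, 2]`. [folklore] -/
theorem mellin_eq_setIntegral (hsupp : Function.support w ⊆ Icc (1 / 2 : ℝ) 2) (z : ℂ) :
    mellin (fun x => (w x : ℂ)) z =
      ∫ u in Icc (1 / 2 : ℝ) 2, ((w u / u : ℝ) : ℂ) * (u : ℂ) ^ z := by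
  unfold mellin
  rw [setIntegral_eq_of_subset_of_forall_sdiff_eq_zero measurableSet_Ioi
    (s := Icc (1 / 2 : ℝ) 2) (fun u hu => Icc_pos hu) ?hz]
  · refine setIntegral_congr_fun measurableSet_Icc fun u hu => ?_
    have hu0 : (u : ℂ) ≠ 0 := by exact_mod_cast (Icc_pos hu).ne'
    simp only [smul_eq_mul]
    rw [Complex.cpow_sub _ _ hu0, Complex.cpow_one]
    push_cast
    ring
  · intro u hu
    have : w u = 0 := by
      by_contra h
      exact hu.2 (hsupp (Function.mem_support.2 h))
    simp [this]

/-- The normalisation `W(0) = 1` in real form: `∫_{1/2}^{2} w(u)/u du = 1`. [folklore] -/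
theorem setIntegral_div_eq_one (hsupp : Function.support w ⊆ Icc (1 / 2 : ℝ) 2)
    (h1 : mellin (fun x => (w x : ℂ)) 0 = 1) : ∫ u in Icc (1 / 2 : ℝ) 2, w u / u = 1 := by
  have h := mellin_eq_setIntegral hsupp 0
  simp only [Complex.cpow_zero, mul_one] at h
  have h2 : ∫ u in Icc (1 / 2 : ℝ) 2, ((w u / u : ℝ) : ℂ) = ((∫ u in Icc (1 / 2 : ℝ) 2, w u / u : ℝ) : ℂ) :=
    integral_ofReal
  rw [h2, h1] at h
  exact_mod_cast h.symm

/-- `u ↦ u^z` is continuous on `[1/2, 2]`. [folklore] -/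
theorem continuousOn_ofReal_cpow (z : ℂ) :
    ContinuousOn (fun u : ℝ => (u : ℂ) ^ z) (Icc (1 / 2 : ℝ) 2) := by
  intro u hu
  apply ContinuousAt.continuousWithinAt
  have h : ContinuousAt (fun v : ℂ => v ^ z) (u : ℂ) :=
    continuousAt_cpow_const (Complex.ofReal_mem_slitPlane.2 (Icc_pos hu))
  exact h.comp Complex.continuous_ofReal.continuousAt

/-- `u ↦ w(u)/u` is continuous on `[1/2, 2]`. [folklore] -/
theorem continuousOn_w_div (hwc : Continuous w) :
    ContinuousOn (fun u : ℝ => w u / u) (Icc (1 / 2 : ℝ) 2) :=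
  hwc.continuousOn.div continuousOn_id fun _ hu => (Icc_pos hu).ne'

/-- `(w(u)/u)·g(u)` is integrable on `[1/2, 2]` for `g` continuous there. [folklore] -/
theorem integrableOn_w_mul (hwc : Continuous w) {g : ℝ → ℂ}
    (hg : ContinuousOn g (Icc (1 / 2 : ℝ) 2)) :
    IntegrableOn (fun u => ((w u / u : ℝ) : ℂ) * g u) (Icc (1 / 2 : ℝ) 2) := by
  apply ContinuousOn.integrableOn_compact isCompact_Icc
  exact (Complex.continuous_ofReal.comp_continuousOn (continuousOn_w_div hwc)).mul hg

/-- `‖∫ (w/u)·g‖ ≤ M` whenever `‖g‖ ≤ M` on `[1/2, 2]` (uses `w ≥ 0` and the normalisation). [folklore] -/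
theorem norm_setIntegral_w_mul_le (hwc : Continuous w) (hw0 : ∀ x, 0 ≤ w x)
    (hn : ∫ u in Icc (1 / 2 : ℝ) 2, w u / u = 1) {g : ℝ → ℂ} {M : ℝ}
    (hM : ∀ u ∈ Icc (1 / 2 : ℝ) 2, ‖g u‖ ≤ M) :
    ‖∫ u in Icc (1 / 2 : ℝ) 2, ((w u / u : ℝ) : ℂ) * g u‖ ≤ M := by
  have hint : IntegrableOn (fun u => w u / u * M) (Icc (1 / 2 : ℝ) 2) :=
    ContinuousOn.integrableOn_compact isCompact_Icc
      ((continuousOn_w_div hwc).mul continuousOn_const)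
  calc ‖∫ u in Icc (1 / 2 : ℝ) 2, ((w u / u : ℝ) : ℂ) * g u‖
      ≤ ∫ u in Icc (1 / 2 : ℝ) 2, w u / u * M := by
        apply norm_integral_le_of_norm_le hint
        rw [ae_restrict_iff' measurableSet_Icc]
        refine Eventually.of_forall fun u hu => ?_
        have hwu : 0 ≤ w u / u := div_nonneg (hw0 u) (Icc_pos hu).le
        rw [norm_mul, Complex.norm_real, Real.norm_eq_abs, abs_of_nonneg hwu]
        exact mul_le_mul_of_nonneg_left (hM u hu) hwu
    _ = (∫ u in Icc (1 / 2 : ℝ) 2, w u / u) * M := integral_mul_const M _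
    _ = M := by rw [hn, one_mul]

/-- `|log u| ≤ 7/10` on `[1/2, 2]`. [folklore] -/
theorem abs_log_le {u : ℝ} (hu : u ∈ Icc (1 / 2 : ℝ) 2) : |Real.log u| ≤ 7 / 10 := by
  have hl2 := Real.log_two_lt_d9
  have hu0 := Icc_pos hu
  have h1 : Real.log u ≤ Real.log 2 := Real.log_le_log hu0 hu.2
  have h2 : Real.log (1 / 2) ≤ Real.log u := Real.log_le_log (by norm_num) hu.1
  have h3 : Real.log (1 / 2) = -Real.log 2 := by
    rw [Real.log_div one_ne_zero two_ne_zero, Real.log_one, zero_sub]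
  rw [abs_le]
  constructor <;> linarith

/-- `‖W(z) - 1‖ ≤ (7/5)·δ` when `‖z‖ ≤ δ ≤ 1/10`. [folklore] -/
theorem norm_mellin_sub_one_le (hwc : Continuous w) (hw0 : ∀ x, 0 ≤ w x)
    (hsupp : Function.support w ⊆ Icc (1 / 2 : ℝ) 2)
    (hn : ∫ u in Icc (1 / 2 : ℝ) 2, w u / u = 1) {z : ℂ} {δ : ℝ} (hz : ‖z‖ ≤ δ)
    (hδ : δ ≤ 1 / 10) : ‖mellin (fun x => (w x : ℂ)) z - 1‖ ≤ 7 / 5 * δ := by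
  have hδ0 : 0 ≤ δ := (norm_nonneg z).trans hz
  have h1c : ∫ u in Icc (1 / 2 : ℝ) 2, ((w u / u : ℝ) : ℂ) = 1 := by
    have h2 : ∫ u in Icc (1 / 2 : ℝ) 2, ((w u / u : ℝ) : ℂ) =
        ((∫ u in Icc (1 / 2 : ℝ) 2, w u / u : ℝ) : ℂ) := integral_ofReal
    rw [h2, hn]
    simp
  have hi1 := integrableOn_w_mul hwc (continuousOn_ofReal_cpow z)
  have hi2 : IntegrableOn (fun u => ((w u / u : ℝ) : ℂ)) (Icc (1 / 2 : ℝ) 2) := by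
    simpa using integrableOn_w_mul hwc (g := fun _ => (1 : ℂ)) continuousOn_const
  have hrepr : mellin (fun x => (w x : ℂ)) z - 1 =
      ∫ u in Icc (1 / 2 : ℝ) 2, ((w u / u : ℝ) : ℂ) * ((u : ℂ) ^ z - 1) := by
    rw [mellin_eq_setIntegral hsupp]
    nth_rewrite 1 [← h1c]
    rw [← integral_sub hi1 hi2]
    refine setIntegral_congr_fun measurableSet_Icc fun u _ => ?_
    ring
  rw [hrepr]
  apply norm_setIntegral_w_mul_le hwc hw0 hn
  intro u hu
  have hu0 := Icc_pos hu
  have hlog : ‖Complex.log (u : ℂ) * z‖ ≤ 7 / 10 * δ := by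
    rw [← Complex.ofReal_log hu0.le, norm_mul, Complex.norm_real, Real.norm_eq_abs]
    exact mul_le_mul (abs_log_le hu) hz (norm_nonneg _) (by norm_num)
  have hle1 : ‖Complex.log (u : ℂ) * z‖ ≤ 1 := by nlinarith
  rw [Complex.cpow_def_of_ne_zero (by exact_mod_cast hu0.ne')]
  calc ‖Complex.exp (Complex.log (u : ℂ) * z) - 1‖ ≤ 2 * ‖Complex.log (u : ℂ) * z‖ :=
        Complex.norm_exp_sub_one_le hle1
    _ ≤ 7 / 5 * δ := by linarith

end Mellin

/-! ## D. The theta-bow configuration -/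

/-- The node `z_x = (-x²/X + iπx/2)/A`. [folklore] -/
def node (X : ℕ) (A : ℝ) (x : ℤ) : ℂ := base X x / A

/-- The node set `Z = {z_x : |x| ≤ X}`. [folklore] -/
def nodes (X : ℕ) (A : ℝ) : Finset ℂ := (Finset.Icc (-(X : ℤ)) X).image (node X A)

/-- Real part of a node: `Re z_x = −x²/(XA)`. [folklore] -/
theorem node_re (X : ℕ) (A : ℝ) (x : ℤ) : (node X A x).re = -((x : ℝ) ^ 2 / X) / A := by
  simp [node, Complex.div_ofReal_re]

/-- Imaginary part of a node: `Im z_x = πx/(2A)` — the ordinates ARE an arithmetic progression of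
step `π/(2A)` through `0` (Maynard–Pratt's lattice step, Remark 13). [folklore] -/
theorem node_im (X : ℕ) (A : ℝ) (x : ℤ) : (node X A x).im = π * x / 2 / A := by
  simp [node, Complex.div_ofReal_im]

/-- The node of index `0` is `0` (the term `c_1 e^{t z_1}` with `z_1 = 0`). [folklore] -/
theorem node_zero (X : ℕ) (A : ℝ) : node X A 0 = 0 := by
  have : base X 0 = 0 := Complex.ext (by simp) (by simp)
  simp [node, this]

/-- Distinct indices give distinct nodes. [folklore] -/
theorem node_injective (X : ℕ) {A : ℝ} (hA : A ≠ 0) : Function.Injective (node X A) := by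
  intro x y h
  have h2 := congrArg Complex.im h
  rw [node_im, node_im] at h2
  have hπ := Real.pi_ne_zero
  field_simp at h2
  exact_mod_cast h2

/-- `0` is a node. [folklore] -/
theorem zero_mem_nodes (X : ℕ) (A : ℝ) : (0 : ℂ) ∈ nodes X A :=
  Finset.mem_image.2 ⟨0, by simp, node_zero X A⟩

/-- All nodes have `Re z ≤ 0` (non-growing terms). [folklore] -/
theorem nodes_re_nonpos (X : ℕ) {A : ℝ} (hA : 0 < A) : ∀ z ∈ nodes X A, z.re ≤ 0 := by
  intro z hz
  obtain ⟨x, -, rfl⟩ := Finset.mem_image.1 hz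
  rw [node_re]
  apply div_nonpos_of_nonpos_of_nonneg _ hA.le
  rw [neg_nonpos]
  positivity

/-- Sums over the node set are sums over the index interval `[-X, X]`. [folklore] -/
theorem sum_nodes_eq {M : Type*} [AddCommMonoid M] (X : ℕ) {A : ℝ} (hA : A ≠ 0) (f : ℂ → M) :
    ∑ z ∈ nodes X A, f z = ∑ x ∈ Finset.Icc (-(X : ℤ)) X, f (node X A x) :=
  Finset.sum_image (node_injective X hA).injOn

/-- Index bounds in real form. [folklore] -/
theorem sq_le_of_mem_Icc {X : ℕ} {x : ℤ} (hx : x ∈ Finset.Icc (-(X : ℤ)) X) :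
    (x : ℝ) ^ 2 ≤ (X : ℝ) ^ 2 ∧ |(x : ℝ)| ≤ X := by
  rw [Finset.mem_Icc] at hx
  have h1 : (-(X : ℝ)) ≤ x := by exact_mod_cast hx.1
  have h2 : (x : ℝ) ≤ X := by exact_mod_cast hx.2
  refine ⟨by nlinarith [abs_le.2 ⟨h1, h2⟩, sq_abs (x : ℝ)], abs_le.2 ⟨h1, h2⟩⟩

/-- The nodes are short: `|Im z_x| ≤ 1/15` and `‖z_x‖ ≤ 1/10` once `A ≥ 30 X`. [folklore] -/
theorem node_small {X : ℕ} {A : ℝ} (hX : 6 ≤ X) (hA : 30 * X ≤ A) {x : ℤ}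
    (hx : x ∈ Finset.Icc (-(X : ℤ)) X) :
    |(node X A x).im| ≤ 1 / 15 ∧ ‖node X A x‖ ≤ 1 / 10 := by
  have hXr : (6 : ℝ) ≤ X := by exact_mod_cast hX
  have hX0 : (0 : ℝ) < X := by linarith
  have hA0 : 0 < A := by linarith
  obtain ⟨hsq, habs⟩ := sq_le_of_mem_Icc hx
  have hπ4 := Real.pi_lt_four
  have hπ0 := Real.pi_pos
  have him : |(node X A x).im| ≤ 1 / 15 := by
    rw [node_im, abs_div, abs_of_pos hA0, div_le_iff₀ hA0, abs_div, abs_mul, abs_of_pos hπ0,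
      abs_of_pos (by norm_num : (0 : ℝ) < 2)]
    rw [div_le_iff₀ (by norm_num : (0 : ℝ) < 2)]
    nlinarith [mul_le_mul_of_nonneg_left habs hπ0.le]
  have hre : |(node X A x).re| ≤ 1 / 30 := by
    rw [node_re, abs_div, abs_of_pos hA0, abs_neg, abs_of_nonneg (by positivity),
      div_le_iff₀ hA0, div_le_iff₀ hX0]
    nlinarith
  refine ⟨him, (Complex.norm_le_abs_re_add_abs_im _).trans ?_⟩
  linarith

/-! ## E. The power sum and the weight `B` for the theta bow -/

section PowerSum

variable {w : ℝ → ℝ} (hwc : Continuous w) (hw0 : ∀ x, 0 ≤ w x)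
  (hsupp : Function.support w ⊆ Icc (1 / 2 : ℝ) 2) (hn : ∫ u in Icc (1 / 2 : ℝ) 2, w u / u = 1)

include hwc hw0 hsupp hn

/-- The power sum of the theta bow is super-polynomially small on `[A, 2A]`:
`‖Σ_z W(z) e^{tz}‖ ≤ 19 X e^{-X/6}`. [folklore] -/
theorem norm_powerSum_le {X : ℕ} {A : ℝ} (hX : 6 ≤ X) (hA : 30 * X ≤ A) {t : ℝ} (ht1 : A ≤ t)
    (ht2 : t ≤ 2 * A) :
    ‖∑ z ∈ nodes X A, mellin (fun x => (w x : ℂ)) z * Complex.exp (t * z)‖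
      ≤ 19 * X * Real.exp (-(X / 6)) := by
  have hXr : (6 : ℝ) ≤ X := by exact_mod_cast hX
  have hA0 : 0 < A := by linarith
  rw [sum_nodes_eq X hA0.ne']
  have hterm : ∀ x : ℤ, mellin (fun x => (w x : ℂ)) (node X A x) * Complex.exp (t * node X A x) =
      ∫ u in Icc (1 / 2 : ℝ) 2, ((w u / u : ℝ) : ℂ) *
        ((u : ℂ) ^ node X A x * Complex.exp (t * node X A x)) := by
    intro x
    rw [mellin_eq_setIntegral hsupp, ← integral_mul_const]
    simp_rw [mul_assoc]
  simp_rw [hterm]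
  have hint : ∀ x ∈ Finset.Icc (-(X : ℤ)) X, IntegrableOn (fun u : ℝ => ((w u / u : ℝ) : ℂ) *
      ((u : ℂ) ^ node X A x * Complex.exp (t * node X A x))) (Icc (1 / 2 : ℝ) 2) := by
    intro x _
    apply integrableOn_w_mul hwc
    exact (continuousOn_ofReal_cpow _).mul continuousOn_const
  rw [← integral_finsetSum _ hint]
  have hpt : ∀ u ∈ Icc (1 / 2 : ℝ) 2,
      ∑ x ∈ Finset.Icc (-(X : ℤ)) X, ((w u / u : ℝ) : ℂ) *
        ((u : ℂ) ^ node X A x * Complex.exp (t * node X A x))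
        = ((w u / u : ℝ) : ℂ) * thetaTrunc X ((t + Real.log u) / A) := by
    intro u hu
    have hu0 := Icc_pos hu
    rw [thetaTrunc, Finset.mul_sum]
    refine Finset.sum_congr rfl fun x _ => ?_
    congr 1
    rw [Complex.cpow_def_of_ne_zero (by exact_mod_cast hu0.ne'), ← Complex.ofReal_log hu0.le,
      ← Complex.exp_add]
    congr 1
    simp only [node]
    push_cast
    field_simp
    ring
  rw [setIntegral_congr_fun measurableSet_Icc hpt]
  apply norm_setIntegral_w_mul_le hwc hw0 hn
  intro u hu
  have hlog := abs_log_le hu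
  rw [abs_le] at hlog
  apply norm_thetaTrunc_le hX
  · rw [le_div_iff₀ hA0]
    nlinarith
  · rw [div_le_iff₀ hA0]
    nlinarith

/-- The weight `B = Σ ‖W(z_x)‖` is comparable to the node count: `(6/7)(2X+1) ≤ B ≤ (8/7)(2X+1)`. [folklore] -/
theorem weight_bounds {X : ℕ} {A : ℝ} (hX : 6 ≤ X) (hA : 30 * X ≤ A) :
    6 / 7 * (2 * X + 1) ≤ ∑ z ∈ nodes X A, ‖mellin (fun x => (w x : ℂ)) z‖ ∧
      ∑ z ∈ nodes X A, ‖mellin (fun x => (w x : ℂ)) z‖ ≤ 8 / 7 * (2 * X + 1) := by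
  have hXr : (6 : ℝ) ≤ X := by exact_mod_cast hX
  have hA0 : 0 < A := by linarith
  rw [sum_nodes_eq X hA0.ne']
  have hcard : ((Finset.Icc (-(X : ℤ)) X).card : ℝ) = 2 * X + 1 := by
    have : (Finset.Icc (-(X : ℤ)) X).card = 2 * X + 1 := by
      rw [Int.card_Icc]
      omega
    rw [this]
    push_cast
    ring
  have hclose : ∀ x ∈ Finset.Icc (-(X : ℤ)) X,
      ‖mellin (fun x => (w x : ℂ)) (node X A x) - 1‖ ≤ 7 / 50 := by
    intro x hx
    have h := norm_mellin_sub_one_le hwc hw0 hsupp hn (node_small hX hA hx).2 le_rfl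
    linarith
  constructor
  · calc 6 / 7 * (2 * (X : ℝ) + 1) ≤ ∑ _x ∈ Finset.Icc (-(X : ℤ)) X, (43 / 50 : ℝ) := by
          rw [Finset.sum_const, nsmul_eq_mul, hcard]
          nlinarith
      _ ≤ _ := Finset.sum_le_sum fun x hx => by
          have h := hclose x hx
          have := norm_sub_norm_le (1 : ℂ) (mellin (fun x => (w x : ℂ)) (node X A x))
          rw [norm_one, norm_sub_rev] at this
          linarith
  · calc ∑ x ∈ Finset.Icc (-(X : ℤ)) X, ‖mellin (fun x => (w x : ℂ)) (node X A x)‖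
        ≤ ∑ _x ∈ Finset.Icc (-(X : ℤ)) X, (57 / 50 : ℝ) := Finset.sum_le_sum fun x hx => by
          have h := hclose x hx
          have := norm_le_norm_add_norm_sub' (mellin (fun x => (w x : ℂ)) (node X A x)) (1 : ℂ)
          rw [norm_one] at this
          linarith
      _ ≤ 8 / 7 * (2 * X + 1) := by
          rw [Finset.sum_const, nsmul_eq_mul, hcard]
          nlinarith

end PowerSum

/-! ## F. Choice of `X` and the main argument -/

/-- For every `C`, all large `X` satisfy `X ≥ 16` and `19 X e^{-X/6} (5X/2)^C ≤ 1`. [folklore] -/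
theorem eventually_X (C : ℝ) :
    ∃ X₀ : ℕ, ∀ X : ℕ, X₀ ≤ X → 16 ≤ X ∧ 19 * X * Real.exp (-(X / 6)) * (5 / 2 * X) ^ C ≤ 1 := by
  have h1 := tendsto_rpow_mul_exp_neg_mul_atTop_nhds_zero (C + 1) (1 / 6) (by norm_num)
  have h2 := h1.const_mul (19 * (5 / 2 : ℝ) ^ C)
  rw [mul_zero] at h2
  have h3 := h2.comp tendsto_natCast_atTop_atTop
  have h4 : ∀ᶠ n : ℕ in atTop,
      19 * (5 / 2 : ℝ) ^ C * (((n : ℝ)) ^ (C + 1) * Real.exp (-(1 / 6) * n)) < 1 :=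
    h3.eventually (gt_mem_nhds one_pos)
  obtain ⟨X₀, hX₀⟩ := eventually_atTop.1 ((eventually_ge_atTop 16).and h4)
  refine ⟨X₀, fun n hn => ?_⟩
  obtain ⟨hn16, hlt⟩ := hX₀ n hn
  refine ⟨hn16, ?_⟩
  have hn0 : (0 : ℝ) < n := by exact_mod_cast (show 0 < n by omega)
  have hexp : Real.exp (-(1 / 6) * (n : ℝ)) = Real.exp (-(n / 6)) := by
    congr 1
    ring
  have heq : 19 * (n : ℝ) * Real.exp (-(n / 6)) * (5 / 2 * n) ^ C =
      19 * (5 / 2 : ℝ) ^ C * ((n : ℝ) ^ (C + 1) * Real.exp (-(1 / 6) * n)) := by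
    rw [Real.mul_rpow (by norm_num) hn0.le, Real.rpow_add_one hn0.ne', hexp]
    ring
  rw [heq]
  exact hlt.le

/-- For every `C` some `X ≥ 16` has `19 X e^{-X/6} (5X/2)^C ≤ 1`. [folklore] -/
theorem exists_X (C : ℝ) :
    ∃ X : ℕ, 16 ≤ X ∧ 19 * X * Real.exp (-(X / 6)) * (5 / 2 * X) ^ C ≤ 1 := by
  obtain ⟨X₀, hX₀⟩ := eventually_X C
  exact ⟨X₀, hX₀ X₀ le_rfl⟩

/-- `e³ < 27`. [folklore] -/
theorem exp_three_lt : Real.exp 3 < 27 := by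
  have h := Real.exp_one_lt_d9
  have h3 : Real.exp 3 = Real.exp 1 ^ 3 := by
    rw [← Real.exp_nat_mul]
    norm_num
  rw [h3]
  have : Real.exp 1 ^ 3 < (2.7182818286 : ℝ) ^ 3 :=
    pow_lt_pow_left₀ h (Real.exp_pos 1).le (by norm_num)
  linarith [show (2.7182818286 : ℝ) ^ 3 < 27 by norm_num]

/-- **The theta bow defeats every window**: for EVERY admissible bump `w` (smoothness is not even
needed, only continuity), the conclusion of the typed crux `InverseTuranLattice`
(stmt-RiemannHypothesis-2994; everything after the hypotheses on `w`, verbatim) fails.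
[cite: MaynardPratt2024, Remark 13 and §8] -/
theorem not_inverseTuranLattice_of_admissible {w : ℝ → ℝ} (hwc : Continuous w) (hw0 : ∀ x, 0 ≤ w x)
    (hsupp : Function.support w ⊆ Icc (1 / 2 : ℝ) 2) (h1 : mellin (fun x => (w x : ℂ)) 0 = 1) :
    ¬ ∃ C₀ : ℝ, ∀ C : ℝ, C₀ ≤ C → ∃ A₀ : ℝ, ∀ A : ℝ, A₀ ≤ A → ∀ (Z : Finset ℂ) (m : ℂ → ℕ),
      (0 : ℂ) ∈ Z → m 0 = 1 → (∀ z ∈ Z, 1 ≤ m z) → (∀ z ∈ Z, z.re ≤ 0) →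
      (∀ t : ℝ, A ≤ t → t ≤ 2 * A →
        ‖∑ z ∈ Z, mellin (fun x => (w x : ℂ)) z * (m z : ℂ) * Complex.exp ((t : ℂ) * z)‖ ≤
          (∑ z ∈ Z, ‖mellin (fun x => (w x : ℂ)) z‖ * (m z : ℝ)) ^ (-C)) →
      ∃ s : ℝ, 0 < s ∧ s * (2 * A + 1) < 2 * Real.pi ∧
        ∀ j : ℤ, |(j : ℝ)| * s ≤ Real.log (∑ z ∈ Z, ‖mellin (fun x => (w x : ℂ)) z‖ * (m z : ℝ)) ^ 3 →
          ∃ z ∈ Z, ‖z - (j : ℂ) * (s : ℂ) * Complex.I‖ ≤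
            (∑ z ∈ Z, ‖mellin (fun x => (w x : ℂ)) z‖ * (m z : ℝ)) ^ (-2 : ℝ) := by
  rintro ⟨C₀, hC₀⟩
  have hn := setIntegral_div_eq_one hsupp h1
  -- our parameters
  set C : ℝ := max C₀ 0 with hC_def
  have hC0 : 0 ≤ C := le_max_right _ _
  obtain ⟨A₀, hA₀⟩ := hC₀ C (le_max_left _ _)
  obtain ⟨X, hX16, hXC⟩ := exists_X C
  have hX6 : 6 ≤ X := by omega
  have hXr : (16 : ℝ) ≤ X := by exact_mod_cast hX16
  set A : ℝ := max A₀ (30 * X) with hA_def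
  have hA30 : 30 * (X : ℝ) ≤ A := le_max_right _ _
  have hA0 : 0 < A := by linarith
  have hmain := hA₀ A (le_max_left _ _) (nodes X A) (fun _ => 1) (zero_mem_nodes X A) rfl
    (fun _ _ => le_rfl) (nodes_re_nonpos X hA0)
  -- the weight B
  set B : ℝ := ∑ z ∈ nodes X A, ‖mellin (fun x => (w x : ℂ)) z‖ with hB_def
  obtain ⟨hBlo, hBhi⟩ := weight_bounds hwc hw0 hsupp hn hX6 hA30
  have hB27 : 27 ≤ B := by rw [hB_def]; linarith
  have hB0 : 0 < B := by linarith
  have hBX : B ≤ 5 / 2 * X := by rw [hB_def]; linarith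
  -- the hypothesis of the claim holds for the theta bow
  have hhyp : ∀ t : ℝ, A ≤ t → t ≤ 2 * A →
      ‖∑ z ∈ nodes X A, mellin (fun x => (w x : ℂ)) z * (((fun _ => 1 : ℂ → ℕ) z : ℕ) : ℂ) *
          Complex.exp ((t : ℂ) * z)‖ ≤
        (∑ z ∈ nodes X A, ‖mellin (fun x => (w x : ℂ)) z‖ *
          (((fun _ => 1 : ℂ → ℕ) z : ℕ) : ℝ)) ^ (-C) := by
    intro t ht1 ht2
    simp only [Nat.cast_one, mul_one]
    have hF := norm_powerSum_le hwc hw0 hsupp hn hX6 hA30 ht1 ht2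
    have hX0 : (0 : ℝ) < X := by linarith
    have h52 : (0 : ℝ) < 5 / 2 * X := by positivity
    calc ‖∑ z ∈ nodes X A, mellin (fun x => (w x : ℂ)) z * Complex.exp ((t : ℂ) * z)‖
        ≤ 19 * X * Real.exp (-(X / 6)) := hF
      _ ≤ (5 / 2 * (X : ℝ)) ^ (-C) := by
          have hpos : 0 < (5 / 2 * (X : ℝ)) ^ C := Real.rpow_pos_of_pos h52 C
          rw [Real.rpow_neg h52.le, inv_eq_one_div, le_div_iff₀ hpos]
          exact hXC
      _ ≤ B ^ (-C) := Real.rpow_le_rpow_of_nonpos hB0 hBX (by linarith)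
  obtain ⟨s, hs0, hsA, hfence⟩ := hmain hhyp
  simp only [Nat.cast_one, mul_one] at hfence
  -- the vacant site
  have hπ4 := Real.pi_lt_four
  have hs1 : s < 1 := by
    nlinarith [mul_le_mul_of_nonneg_left (show (961 : ℝ) ≤ 2 * A + 1 by linarith) hs0.le]
  have hlogB : 3 ≤ Real.log B := by
    have := Real.log_le_log (Real.exp_pos 3) (le_trans exp_three_lt.le hB27)
    rwa [Real.log_exp] at this
  have hL : 27 ≤ Real.log B ^ 3 := by
    have := pow_le_pow_left₀ (by norm_num : (0 : ℝ) ≤ 3) hlogB 3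
    linarith [show (3 : ℝ) ^ 3 = 27 by norm_num]
  set L : ℝ := Real.log B ^ 3 with hL_def
  set j : ℤ := ⌊L / s⌋ with hj_def
  have hj0 : 0 ≤ j := Int.floor_nonneg.2 (by positivity)
  have hjs : (j : ℝ) * s ≤ L := by
    have := Int.floor_le (L / s)
    rw [← hj_def] at this
    rwa [le_div_iff₀ hs0] at this
  have hjs' : L - s < j * s := by
    have := Int.lt_floor_add_one (L / s)
    rw [← hj_def, div_lt_iff₀ hs0] at this
    linarith
  have hj0r : (0 : ℝ) ≤ j := by exact_mod_cast hj0
  obtain ⟨z, hz, hdist⟩ := hfence j (by rwa [abs_of_nonneg hj0r])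
  obtain ⟨x, hx, rfl⟩ := Finset.mem_image.1 hz
  have him := (node_small hX6 hA30 hx).1
  have hB2 : B ^ (-2 : ℝ) ≤ 1 := Real.rpow_le_one_of_one_le_of_nonpos (by linarith) (by norm_num)
  have hcomp : (node X A x - (j : ℂ) * (s : ℂ) * Complex.I).im = (node X A x).im - j * s := by
    simp
  have habs := Complex.abs_im_le_norm (node X A x - (j : ℂ) * (s : ℂ) * Complex.I)
  rw [hcomp] at habs
  rw [abs_le] at him
  have : |(node X A x).im - j * s| ≤ 1 := habs.trans (hdist.trans hB2)
  rw [abs_le] at this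
  linarith [this.1]

/-! ## G. A concrete admissible bump -/

/-- A smooth bump centred at `1` with radii `1/4 < 1/2`. [folklore] -/
def bump : ContDiffBump (1 : ℝ) := ⟨1 / 4, 1 / 2, by norm_num, by norm_num⟩

/-- Outer radius of `bump`. [folklore] -/
theorem bump_rOut : bump.rOut = 1 / 2 := rfl

/-- Off `(1/2, 3/2)` the normalised bump vanishes. [folklore] -/
theorem bump_normed_eq_zero {x : ℝ} (hx : x ∉ Ioo (1 / 2 : ℝ) (3 / 2)) :
    bump.normed volume x = 0 := by
  rw [← Function.notMem_support, ContDiffBump.support_normed_eq, Real.ball_eq_Ioo, bump_rOut]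
  intro h
  apply hx
  constructor <;> linarith [h.1, h.2]

/-- The admissible weight `w(x) = x · φ̃(x)` (`φ̃` the normalised bump), so that `w(x)/x = φ̃(x)`
integrates to `1` against `dx`, i.e. `W(0) = 1`. [folklore] -/
def wit (x : ℝ) : ℝ := x * bump.normed volume x

/-- `wit` is smooth. [folklore] -/
theorem wit_contDiff : ContDiff ℝ (⊤ : ℕ∞) wit :=
  contDiff_id.mul bump.contDiff_normed

/-- `supp wit ⊆ [1/2, 2]` (indeed `⊆ (1/2, 3/2)`). [folklore] -/
theorem wit_support : Function.support wit ⊆ Icc (1 / 2 : ℝ) 2 := by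
  intro x hx
  by_contra hx'
  apply hx
  have : x ∉ Ioo (1 / 2 : ℝ) (3 / 2) := fun h => hx' ⟨h.1.le, by linarith [h.2]⟩
  simp [wit, bump_normed_eq_zero this]

/-- `wit ≥ 0`. [folklore] -/
theorem wit_nonneg (x : ℝ) : 0 ≤ wit x := by
  unfold wit
  by_cases hx : 0 ≤ x
  · exact mul_nonneg hx (bump.nonneg_normed x)
  · have : x ∉ Ioo (1 / 2 : ℝ) (3 / 2) := fun h => hx (by linarith [h.1])
    simp [bump_normed_eq_zero this]

/-- Normalisation `W(0) = mellin wit 0 = ∫ φ̃ = 1`. [folklore] -/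
theorem wit_mellin_zero : mellin (fun x => (wit x : ℂ)) 0 = 1 := by
  unfold mellin
  have h1 : ∫ t : ℝ in Ioi 0, (t : ℂ) ^ ((0 : ℂ) - 1) • ((wit t : ℝ) : ℂ) =
      ∫ t : ℝ in Ioi 0, ((bump.normed volume t : ℝ) : ℂ) := by
    refine setIntegral_congr_fun measurableSet_Ioi fun t ht => ?_
    have ht0 : (t : ℂ) ≠ 0 := by exact_mod_cast (ne_of_gt ht)
    simp only [zero_sub, Complex.cpow_neg_one, smul_eq_mul, wit]
    push_cast
    field_simp
  have h2 : ∫ t : ℝ in Ioi 0, ((bump.normed volume t : ℝ) : ℂ) =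
      ∫ t : ℝ, ((bump.normed volume t : ℝ) : ℂ) := by
    apply setIntegral_eq_integral_of_forall_compl_eq_zero
    intro t ht
    have : t ∉ Ioo (1 / 2 : ℝ) (3 / 2) := fun h => ht (show (0 : ℝ) < t by linarith [h.1])
    simp [bump_normed_eq_zero this]
  have h3 : ∫ t : ℝ, ((bump.normed volume t : ℝ) : ℂ) =
      ((∫ t : ℝ, bump.normed volume t : ℝ) : ℂ) := integral_ofReal
  rw [h1, h2, h3, bump.integral_normed]
  simp

end ThetaBow

open ThetaBow

/-- **Barrier `ThetaBowInvisibility` (chirped theta bows; Jacobi).** For every continuous bump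
`w ≥ 0` supported in `[1/2, 2]` with `W(0) = 1` (`W = mellin w`) and every exponent `C`: for all
large `X` and every `A ≥ 30X`, the theta bow `Z = {z_x = (−x²/X + iπx/2)/A : |x| ≤ X}` (which
contains `0`, has `Re z ≤ 0`, `|Im z| ≤ 1/15`, `‖z‖ ≤ 1/10` for all its nodes, and weight
`27 ≤ B = Σ_{z∈Z} ‖W(z)‖ ≤ 5X/2`) has `sup_{t ∈ [A,2A]} ‖Σ_{z∈Z} W(z) e^{tz}‖ ≤ B^{−C}`.

BARRIER (structured block, D-0021):
- technique_class: inverse-Turan two-sided-positive-power-sums short-interval-power-sum-lower-bounds fence-dichotomy lattice-forcing-from-uniform-smallness zero-detection-by-short-prime-sums Maynard-Pratt-detectors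
- blocks: deriving, from uniform `B^{−C}`-smallness on `[A, 2A]` of a two-sided power sum `Σ_r W(z_r) m_r e^{t z_r}` with bump coefficients (`z_1 = 0`, `Re z_r ≤ 0`), that the nodes near `0` lie on / fill a vertical (near-)arithmetic progression of any prescribed extent, at a common abscissa or within tolerance `B^{−2}` of the sites `ijs` — in particular the crux `InverseTuranLattice` (stmt-RiemannHypothesis-2994) of route `RiemannHypothesis/Fences` rev ≤ 2 and with it the FENCED alternative of `FenceDichotomy` / `NoFences` as typed there (`not_inverseTuranLattice`) [cite: MaynardPratt2024, §2.2 and §8]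
- because: Gaussian-damped chirps are super-polynomially small by Jacobi's imaginary transformation, uniformly in the bump: `F(t) = ∫ (w(u)/u) G_X((t+log u)/A) du` with `G_X(τ) = Σ_{|x|≤X} e^{−(τ/X)x² + i(πτ/2)x}`, whose Poisson dual `√(πX/τ) Σ_n e^{−(π²X/τ)(n − τ/4)²}` has its centre `τ/4 ∈ [1/5, 11/20]` bounded away from `ℤ` ("`−t/(4A)` is always at least `1/4` away from any integer", the same arithmetic as the lattice example), so `‖F(t)‖ ≤ 19Xe^{−X/6} ≤ B^{−C}` while the whole configuration sits in the disc `‖z‖ ≤ 1/10` with abscissae diving to depth `x²/(XA) ≫ B^{−2}` (`thetaBowInvisibility_holds`, `ThetaBow.norm_powerSum_le`, Mathlib `Complex.tsum_exp_neg_quadratic`) [cite: MaynardPratt2024, Remark 13]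
- evasions_known: ONE-sided configurations (`Im z_r ≥ Im z_1`) are detected — Maynard–Pratt Lemma 11 with exponent `99`, whence Prop. 16 for half-isolated zeros; the theta bow is two-sided by necessity (a Gaussian centred off `0` would need `Re z > 0`) [cite: MaynardPratt2024, Lemma 11 and Remark 13]; statements that only assert near neighbours of `0` on BOTH sides within `O(1/A)`, or a chain of `≳ C log B` nodes with gaps `< 2π/(2A+1)` inside height `O(C log B/A)`, are satisfied by theta bows and are not addressed here [folklore]
- status: established (kernel-checked in this file; axioms `propext`, `Classical.choice`, `Quot.sound`)
- scope_caveats: the formal witness has real chirp parameter (ordinates in exact progression `πx/(2A)`, i.e. a fence of height `≤ 1/15` only) and kills lattice conclusions through their WINDOW (`(log B)³ ≥ 27`) and TOLERANCE (`B^{−2}` versus bow depth `x²/(XA)`); the complex-chirp variant `z_x = (−(0.8−0.4i)x²/X + iπx/2)/A`, which has no progression in its ordinates either, is equally invisible but is documented only numerically/on paper (refuter evidence on stmt-RiemannHypothesis-2994, 2026-08-16) [folklore]; `A ≥ 30X` and the constants `19`, `1/6`, `6/7`, `8/7`, `1/15`, `1/10` are crude; `W` enters only through `w ≥ 0`, `supp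 w ⊆ [1/2,2]`, `∫ w(u)du/u = 1`, so decay hypotheses on `W` (Maynard–Pratt Lemma 43) do not affect the barrier [cite: MaynardPratt2024, Lemma 43]

[cite: MaynardPratt2024, §2.2, Remark 13, §8] [cite: Montgomery1994, ch. 5] -/
def ThetaBowInvisibility : Prop :=
  ∀ w : ℝ → ℝ, Continuous w → (∀ x, 0 ≤ w x) → Function.support w ⊆ Set.Icc (1 / 2) 2 →
    mellin (fun x => (w x : ℂ)) 0 = 1 →
  ∀ C : ℝ, ∃ X₀ : ℕ, ∀ X : ℕ, X₀ ≤ X → ∀ A : ℝ, 30 * X ≤ A →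
    (0 : ℂ) ∈ ThetaBow.nodes X A ∧
    (∀ z ∈ ThetaBow.nodes X A, z.re ≤ 0 ∧ |z.im| ≤ 1 / 15 ∧ ‖z‖ ≤ 1 / 10) ∧
    27 ≤ ∑ z ∈ ThetaBow.nodes X A, ‖mellin (fun x => (w x : ℂ)) z‖ ∧
    ∑ z ∈ ThetaBow.nodes X A, ‖mellin (fun x => (w x : ℂ)) z‖ ≤ 5 / 2 * X ∧
    ∀ t : ℝ, A ≤ t → t ≤ 2 * A →
      ‖∑ z ∈ ThetaBow.nodes X A, mellin (fun x => (w x : ℂ)) z * Complex.exp ((t : ℂ) * z)‖ ≤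
        (∑ z ∈ ThetaBow.nodes X A, ‖mellin (fun x => (w x : ℂ)) z‖) ^ (-C)

/-- The barrier holds (fully proved). [cite: MaynardPratt2024, Remark 13 and §8] -/
theorem thetaBowInvisibility_holds : ThetaBowInvisibility := by
  intro w hwc hw0 hsupp h1 C
  have hn := setIntegral_div_eq_one hsupp h1
  set C' : ℝ := max C 0 with hC'_def
  obtain ⟨X₀, hX₀⟩ := eventually_X C'
  refine ⟨X₀, fun X hX A hA => ?_⟩
  obtain ⟨hX16, hXC⟩ := hX₀ X hX
  have hX6 : 6 ≤ X := by omega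
  have hXr : (16 : ℝ) ≤ X := by exact_mod_cast hX16
  have hA0 : 0 < A := by linarith
  obtain ⟨hBlo, hBhi⟩ := weight_bounds hwc hw0 hsupp hn hX6 hA
  set B : ℝ := ∑ z ∈ nodes X A, ‖mellin (fun x => (w x : ℂ)) z‖ with hB_def
  have hB27 : 27 ≤ B := by rw [hB_def]; linarith
  have hB0 : 0 < B := by linarith
  have hBX : B ≤ 5 / 2 * X := by rw [hB_def]; linarith
  refine ⟨zero_mem_nodes X A, fun z hz => ?_, hB27, hBX, fun t ht1 ht2 => ?_⟩
  · obtain ⟨x, hx, rfl⟩ := Finset.mem_image.1 hz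
    exact ⟨nodes_re_nonpos X hA0 _ hz, (node_small hX6 hA hx).1, (node_small hX6 hA hx).2⟩
  · have hF := norm_powerSum_le hwc hw0 hsupp hn hX6 hA ht1 ht2
    have hX0 : (0 : ℝ) < X := by linarith
    have h52 : (0 : ℝ) < 5 / 2 * X := by positivity
    calc ‖∑ z ∈ nodes X A, mellin (fun x => (w x : ℂ)) z * Complex.exp ((t : ℂ) * z)‖
        ≤ 19 * X * Real.exp (-(X / 6)) := hF
      _ ≤ (5 / 2 * (X : ℝ)) ^ (-C') := by
          have hpos : 0 < (5 / 2 * (X : ℝ)) ^ C' := Real.rpow_pos_of_pos h52 C'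
          rw [Real.rpow_neg h52.le, inv_eq_one_div, le_div_iff₀ hpos]
          exact hXC
      _ ≤ B ^ (-C') := Real.rpow_le_rpow_of_nonpos hB0 hBX (by simp [hC'_def])
      _ ≤ B ^ (-C) := Real.rpow_le_rpow_of_exponent_le (by linarith) (by simp [hC'_def])

/-- **Corollary: the typed crux `InverseTuranLattice` (stmt-RiemannHypothesis-2994, route
`RiemannHypothesis/Fences` rev ≤ 2) is false.** The statement below is, verbatim, the ledger
signature of that item (the informal item of Maynard–Pratt's §8 question typed literally: `W` a
Mellin transform of a smooth bump with `W(0) = 1`, `z_1 = 0`, `c_1 = 1`, `Re z_r ≤ 0`, positive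
integer multiplicities, `B = Σ|c_r|`; conclusion: a fully occupied near-lattice of step
`s(2A+1) < 2π`, tolerance `B^{−2}`, window `(log B)³`). Witness: `w = ThetaBow.wit` and the theta
bow (`ThetaBow.not_inverseTuranLattice_of_admissible`, valid for every admissible `w`).
[cite: MaynardPratt2024, §8] -/
theorem not_inverseTuranLattice :
    ¬ (∀ w : ℝ → ℝ, ContDiff ℝ (⊤ : ℕ∞) w → (∀ x, 0 ≤ w x) → Function.support w ⊆ Set.Icc (1 / 2) 2 → mellin (fun x => (w x : ℂ)) 0 = 1 → ∃ C₀ : ℝ, ∀ C : ℝ, C₀ ≤ C → ∃ A₀ : ℝ, ∀ A : ℝ, A₀ ≤ A → ∀ (Z : Finset ℂ) (m : ℂ → ℕ), (0 : ℂ) ∈ Z → m 0 = 1 → (∀ z ∈ Z, 1 ≤ m z) → (∀ z ∈ Z, z.re ≤ 0) → (∀ t : ℝ, A ≤ t → t ≤ 2 * A → ‖∑ z ∈ Z, mellin (fun x => (w x : ℂ)) z * (m z : ℂ) * Complex.exp ((t : ℂ) * z)‖ ≤ (∑ z ∈ Z, ‖mellin (fun x => (w x : ℂ)) z‖ * (m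 z : ℝ)) ^ (-C)) → ∃ s : ℝ, 0 < s ∧ s * (2 * A + 1) < 2 * Real.pi ∧ ∀ j : ℤ, |(j : ℝ)| * s ≤ Real.log (∑ z ∈ Z, ‖mellin (fun x => (w x : ℂ)) z‖ * (m z : ℝ)) ^ 3 → ∃ z ∈ Z, ‖z - (j : ℂ) * (s : ℂ) * Complex.I‖ ≤ (∑ z ∈ Z, ‖mellin (fun x => (w x : ℂ)) z‖ * (m z : ℝ)) ^ (-2 : ℝ)) := fun h =>
  not_inverseTuranLattice_of_admissible wit_contDiff.continuous wit_nonneg wit_support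
    wit_mellin_zero (h wit wit_contDiff wit_nonneg wit_support wit_mellin_zero)

end Literature.Barriers.RiemannHypothesis
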